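import Summits.MatrixMultiplication.OmegaCensus.STPPSmallPatternKernelSearchX2

/-!
# ω-census, small STPP pattern `(2,1,1)^k`: kernel search — STABILISER normal form and a GLOBAL exclusion mask

HONEST FRAMING (pub-omega census; verbatim): lottery ticket; floor = certified bounds/negative ranges.
Census STRUCTURE bookkeeping of the STPP track (seat pub-omega-eng2 = ENG2, gen 34, on the engine + reflection of seat
pub-omega-stpp-3 gen 23 and ENG2 gen 33's two-level chunks; STRUCTURE row B5, threshold column `T1(H) = max {k : (2,1,1)^k ⊆ H}`,
its LOWER sides as kernel theorems), not progress on `ω`: small patterns in small groups bound no exponent.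

The normal form of `STPPSmallPatternKernelReflect.lean` spends the automorphisms of `G` on the representative `d` of `A₀ = {0, d}`
only.  The STABILISER of `±d` (listed injective additive `ψ` with `ψ d = ±d`; the `−` kind followed by translating the pairs by
`d`) still acts on the `c`'s: a further normal-form step (`exists_stabMin`, a well-founded descent on the code of `c₁`; no closure
property of the list is needed) makes the code of `c₁` MINIMAL among the codes of all `ψ cⱼ`, `j ≠ 0`.  Hence `c₁` ranges over
CANONICAL codes only and no later `cⱼ` has a listed image coded below `c₁` — a GLOBAL exclusion mask valid at every level.
Engine (definitional glue around the untouched `level`, whose `level_false` takes any exclusion mask): `belowG g xg` (free search,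
`c ∉ xg` at every level), `belowX3G g r x1 x2 x3 xg` (levels 1–3 restricted by `x1, x2, x3`, then `belowG xg`), `search3 g k chunks`
over chunks `(d, x1, x2, x3, xg)`, `search3_cons/_append`, `search3_map_eq_search2` (two-level chunks are chunks `(d, x1, x2, 0, 0)`).
Reflection along `STPPSmallPatternKernelReflect.lean` §7–§9: `belowG_false`, `start_false3`, `exists_stabMin`,
`not_modelD_of_search3`, and the per-group files' `not_exists_isSTPP_211_of_search3` — **if `search3 E.g K chunks = true`
(`K ≥ 2`), every nonzero `d` is carried into the representative list by a listed injective map, the listed stabiliser maps of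
each representative `δ` are injective with `ψ δ = ±δ`, every canonical `y ∉ {0, ±δ}` appears in the table `canon` with a mask
`b` containing only codes having a listed image below `y`, and for every such `(y, b)` and all codes `y₂, y₃` outside `b` some
chunk of `δ` admits `(y, y₂, y₃)` with `x3, xg ⊆ b` (the masks `x2`, `x3` may contain `b`), then `G` admits no STPP family
(CKSU Def. 5.1, tree `IsSTPP`) of `K` triples with `|Aᵢ| = 2`, `|Bᵢ| = |Cᵢ| = 1.**  All side conditions are kernel decisions.

References: H. Cohn, R. Kleinberg, B. Szegedy, C. Umans, *Group-theoretic algorithms for matrix multiplication*, FOCS 2005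
(arXiv:math/0511460), Def. 5.1.  Record: pub-omega HOME `pub-omega-eng2-g34/` (C mirror `k211g.c` with the global mask; measured:
orders 27–29 of the `k = 6` NONE side drop from 1397·10⁶ to 581·10⁶ mask translations).
-/

open Literature.Computability.AlgebraicComplexity

namespace Summit.MatrixMultiplication.OmegaCensus

namespace STPP211Neg

/-! ## 1. The search with a global exclusion mask -/

/-- The free search below a state with `c ∉ xg` at EVERY level (`r` triples still to place; `true` = refuted). -/
noncomputable def belowG (g : GC) (xg : ℕ) : ℕ → St → Bool :=
  @Nat.rec (fun _ => St → Bool) (fun _ => false) (fun r ih S => level g S r xg ih)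

/-- One level restricted to `c ∉ x3`, then `belowG xg`. -/
noncomputable def belowX1G (g : GC) (r x3 xg : ℕ) : St → Bool :=
  @Nat.rec (fun _ => St → Bool) (fun _ => false) (fun r' _ S => level g S r' x3 (belowG g xg r')) r

/-- One level restricted to `c ∉ x2`, then `belowX1G x3 xg`. -/
noncomputable def belowX2G (g : GC) (r x2 x3 xg : ℕ) : St → Bool :=
  @Nat.rec (fun _ => St → Bool) (fun _ => false) (fun r' _ S => level g S r' x2 (belowX1G g r' x3 xg)) r

/-- Below the start state, `r` triples to place: the FIRST level restricted to `c ∉ x1`, the SECOND to `c ∉ x2`, the THIRD to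
`c ∉ x3`, and every deeper level to `c ∉ xg`. -/
noncomputable def belowX3G (g : GC) (r x1 x2 x3 xg : ℕ) : St → Bool :=
  @Nat.rec (fun _ => St → Bool) (fun _ => false) (fun r' _ S => level g S r' x1 (belowX2G g r' x2 x3 xg)) r

/-- THE SEARCH over chunks `(d, x1, x2, x3, xg)` (representative `d` of `A₀ = {0, d}`, exclusion masks of the first three
levels, global exclusion mask of the deeper levels): `true` certifies that no normal-form solution of the difference model with
`q₀ = d`, `c₁ ∉ x1`, `c₂ ∉ x2`, `c₃ ∉ x3` and every `cⱼ ∉ xg` (`j ≥ 1`) exists (reflection below). -/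
noncomputable def search3 (g : GC) (k : ℕ) (chunks : List (ℕ × ℕ × ℕ × ℕ × ℕ)) : Bool :=
  @List.rec (ℕ × ℕ × ℕ × ℕ × ℕ) (fun _ => Bool) true
    (fun e _ ih => start g (Nat.sub k 1) e.1 (belowX3G g (Nat.sub k 1) e.2.1 e.2.2.1 e.2.2.2.1 e.2.2.2.2) && ih) chunks

/-- `search3` on a cons (used to split kernel evaluations by chunk). -/
theorem search3_cons (g : GC) (k : ℕ) (e : ℕ × ℕ × ℕ × ℕ × ℕ) (R : List (ℕ × ℕ × ℕ × ℕ × ℕ)) :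
    search3 g k (e :: R) =
      (start g (k - 1) e.1 (belowX3G g (k - 1) e.2.1 e.2.2.1 e.2.2.2.1 e.2.2.2.2) && search3 g k R) := rfl

/-- `search3` is a conjunction over the chunk list. -/
theorem search3_append (g : GC) (k : ℕ) (R₁ R₂ : List (ℕ × ℕ × ℕ × ℕ × ℕ)) :
    search3 g k (R₁ ++ R₂) = (search3 g k R₁ && search3 g k R₂) := by
  induction R₁ with
  | nil => rfl
  | cons e R ih => rw [List.cons_append, search3_cons, search3_cons, ih, Bool.and_assoc]

/-! ## 2. Reflection: the branch of a normal-form solution avoiding the global mask is never refuted -/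

section Main

variable {G : Type} [AddCommGroup G] {E : GEnc G} {K : ℕ} {p q c : Fin K → G}

/-- THE GLOBALLY RESTRICTED SEARCH BELOW A STATE OF THE SOLUTION'S BRANCH ANSWERS `false`, provided every `cⱼ` (`j ≥ 1`) is
coded outside the global mask (induction on the number of triples left; each level is `level_false`). -/
theorem belowG_false (hM : ModelD p q c) (hNF : NF E p q c) {xg : ℕ}
    (hxg : ∀ j : Fin K, 1 ≤ j.val → xg.testBit (E.enc (c j)) = false) :
    ∀ (r m : ℕ) (ip : Fin K) (S : St), m + r = K → ip.val + 1 = m → InvM E p q c m S → S.last = E.enc (c ip) →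
      belowG E.g xg r S = false := by
  intro r
  induction r with
  | zero => intro m ip S _ _ _ _; rfl
  | succ r ih =>
      intro m ip S hmr hip hS hlast
      have hmK : m < K := by omega
      show level E.g S r xg (belowG E.g xg r) = false
      exact level_false (m := m) (r := r) hM hNF (by omega) ⟨m, hmK⟩ rfl ip hip hS hlast (hxg ⟨m, hmK⟩ (by simp; omega))
        fun S' hS' hl' => ih (m + 1) ⟨m, hmK⟩ S' (by omega) rfl hS' hl'

/-- THE START OF THE SOLUTION'S CHUNK ANSWERS `false` (three restricted levels, then the global mask): normal-form solution with
`c₀ = 0`, `p₀ = 0`, `q₀ = d`, the level exclusions missing the codes of `c₁`, `c₂`, `c₃` (each if it exists) and the global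
exclusion missing the code of every `cⱼ`, `j ≥ 1`. -/
theorem start_false3 (hM : ModelD p q c) (hNF : NF E p q c) (hK : 0 < K) (hc0 : c ⟨0, hK⟩ = 0) (hp0 : p ⟨0, hK⟩ = 0)
    {x1 x2 x3 xg : ℕ} (hx1 : ∀ h1 : 1 < K, x1.testBit (E.enc (c ⟨1, h1⟩)) = false)
    (hx2 : ∀ h2 : 2 < K, x2.testBit (E.enc (c ⟨2, h2⟩)) = false)
    (hx3 : ∀ h3 : 3 < K, x3.testBit (E.enc (c ⟨3, h3⟩)) = false)
    (hxg : ∀ j : Fin K, 1 ≤ j.val → xg.testBit (E.enc (c j)) = false) :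
    start E.g (K - 1) (E.enc (q ⟨0, hK⟩)) (belowX3G E.g (K - 1) x1 x2 x3 xg) = false := by
  unfold start
  have h0 : (0 : ℕ) = E.enc (c ⟨0, hK⟩) := by rw [hc0, E.enc_zero]
  have h0' : (0 : ℕ) = E.enc (p ⟨0, hK⟩) := by rw [hp0, E.enc_zero]
  conv_lhs => rw [show (child E.g St.empty (K - 1) 0 0 (E.enc (q ⟨0, hK⟩)) 0 0 0 (belowX3G E.g (K - 1) x1 x2 x3 xg)) =
    child E.g St.empty (K - 1) (E.enc (c ⟨0, hK⟩)) (E.enc (p ⟨0, hK⟩)) (E.enc (q ⟨0, hK⟩)) 0 0 0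
      (belowX3G E.g (K - 1) x1 x2 x3 xg) by rw [← h0, ← h0']]
  refine child_false hM hNF (m := 0) (r := K - 1) (by omega) ⟨0, hK⟩ rfl (invM_empty E p q c) (MSub_zero E _)
    (MSub_zero E _) (MSub_zero E _) fun S₁ hS₁ hl₁ => ?_
  unfold belowX3G
  rcases Nat.eq_zero_or_pos (K - 1) with hK1 | hK1
  · rw [hK1]; rfl
  · obtain ⟨r, hr⟩ : ∃ r, K - 1 = r + 1 := ⟨K - 1 - 1, by omega⟩
    rw [hr]
    show level E.g S₁ r x1 (belowX2G E.g r x2 x3 xg) = false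
    have h1 : 1 < K := by omega
    refine level_false (m := 1) (r := r) hM hNF (by omega) ⟨1, h1⟩ rfl ⟨0, hK⟩ rfl hS₁ hl₁ (hx1 h1)
      fun S₂ hS₂ hl₂ => ?_
    unfold belowX2G
    rcases Nat.eq_zero_or_pos r with hr0 | hr0
    · rw [hr0]; rfl
    · obtain ⟨r', hr'⟩ : ∃ r', r = r' + 1 := ⟨r - 1, by omega⟩
      rw [hr']
      show level E.g S₂ r' x2 (belowX1G E.g r' x3 xg) = false
      have h2 : 2 < K := by omega
      refine level_false (m := 2) (r := r') hM hNF (by omega) ⟨2, h2⟩ rfl ⟨1, h1⟩ rfl hS₂ hl₂ (hx2 h2)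
        fun S₃ hS₃ hl₃ => ?_
      unfold belowX1G
      rcases Nat.eq_zero_or_pos r' with hr'0 | hr'0
      · rw [hr'0]; rfl
      · obtain ⟨r'', hr''⟩ : ∃ r'', r' = r'' + 1 := ⟨r' - 1, by omega⟩
        rw [hr'']
        show level E.g S₃ r'' x3 (belowG E.g xg r'') = false
        have h3 : 3 < K := by omega
        exact level_false (m := 3) (r := r'') hM hNF (by omega) ⟨3, h3⟩ rfl ⟨2, h2⟩ rfl hS₃ hl₃ (hx3 h3)
          fun S₄ hS₄ hl₄ => belowG_false hM hNF hxg r'' 4 ⟨3, h3⟩ S₄ (by omega) rfl hS₄ hl₄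

/-- A `true` search refutes every listed chunk. -/
theorem start_of_search3 {g : GC} {k : ℕ} : ∀ {R : List (ℕ × ℕ × ℕ × ℕ × ℕ)}, search3 g k R = true → ∀ e ∈ R,
    start g (k - 1) e.1 (belowX3G g (k - 1) e.2.1 e.2.2.1 e.2.2.2.1 e.2.2.2.2) = true := by
  intro R
  induction R with
  | nil => intro _ e he; simp at he
  | cons e' R ih =>
      intro h e he
      rw [search3_cons, Bool.and_eq_true] at h
      rcases List.mem_cons.1 he with rfl | he
      · exact h.1
      · exact ih h.2 e he

end Main

/-! ## 3. The stabiliser normal form -/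

section Stab

variable {G : Type} [AddCommGroup G] {K : ℕ}

/-- In a solution with `c_{i₀} = 0` and `A_{i₀} = {0, δ}`, every other `cⱼ` avoids `{0, δ, −δ}` (`= A_{i₀} − A_{i₀}`). -/
theorem ModelD.c_notMem {p q c : Fin K → G} (hM : ModelD p q c) {i0 j : Fin K} (hj : j ≠ i0) (hc0 : c i0 = 0)
    (hp0 : p i0 = 0) {δ : G} (hq0 : q i0 = δ) : c j ≠ 0 ∧ c j ≠ δ ∧ c j ≠ -δ := by
  have h := fun x y (hx : InA p q i0 x) (hy : InA p q i0 y) => hM.2.2 i0 j i0 x y hj hx hy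
  refine ⟨fun e => h (p i0) (p i0) (inA_p i0) (inA_p i0) ?_, fun e => h (q i0) (p i0) (inA_q i0) (inA_p i0) ?_,
    fun e => h (p i0) (q i0) (inA_p i0) (inA_q i0) ?_⟩
  · rw [sub_self, hc0, sub_zero, e]
  · rw [hq0, hp0, hc0, sub_zero, sub_zero, e]
  · rw [hp0, hq0, hc0, zero_sub, sub_zero, e]

/-- ONE STABILISER STEP.  A solution with `c₀ = 0`, `A₀ = {0, δ}` and an injective additive `ψ` with `ψ δ = ±δ`:
applying `ψ` (and, if `ψ δ = −δ`, translating the pairs by `δ`), re-sorting the indices by the code of `c` and re-orienting the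
pairs gives a normal-form solution with the same `c₀ = 0`, `A₀ = {0, δ}`, whose `c₁` is coded at most the code of `ψ cⱼ` for
any prescribed `j ≠ 0`. -/
theorem stabStep (E : GEnc G) (hK : 1 < K) {p q c : Fin K → G} (hM : ModelD p q c)
    (hc0 : c ⟨0, by omega⟩ = 0) (hp0 : p ⟨0, by omega⟩ = 0) {δ : G} (hq0 : q ⟨0, by omega⟩ = δ)
    (ψ : G →+ G) (hψ : Function.Injective ψ) (hψδ : ψ δ = δ ∨ ψ δ = -δ) (j : Fin K) (hj : j ≠ ⟨0, by omega⟩) :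
    ∃ p' q' c' : Fin K → G, ModelD p' q' c' ∧ NF E p' q' c' ∧ c' ⟨0, by omega⟩ = 0 ∧ p' ⟨0, by omega⟩ = 0 ∧
      q' ⟨0, by omega⟩ = δ ∧ E.enc (c' ⟨1, hK⟩) ≤ E.enc (ψ (c j)) := by
  have hK0 : 0 < K := by omega
  set i0 : Fin K := ⟨0, hK0⟩
  set i1 : Fin K := ⟨1, hK⟩
  have hδ0 : δ ≠ 0 := fun h => hM.1 i0 (by rw [hp0, hq0, h])
  classical
  -- step 1: apply ψ after translating the pairs by t (t = 0 if ψ δ = δ, t = δ if ψ δ = −δ)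
  set t : G := if ψ δ = δ then 0 else δ
  set p1 : Fin K → G := fun i => ψ (p i - t)
  set q1 : Fin K → G := fun i => ψ (q i - t)
  set c1 : Fin K → G := fun i => ψ (c i - 0)
  have hM1 : ModelD p1 q1 c1 := hM.map_sub ψ hψ t 0
  have hc1 : c1 i0 = 0 := by simp [c1, hc0]
  have hc1j : ∀ i, c1 i = ψ (c i) := fun i => by simp [c1]
  -- the pair at i0 is {0, δ} as a set
  have hpair : (p1 i0 = 0 ∧ q1 i0 = δ) ∨ (p1 i0 = δ ∧ q1 i0 = 0) := by
    by_cases h : ψ δ = δ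
    · have ht : t = 0 := by simp [t, h]
      exact Or.inl ⟨by simp [p1, ht, hp0], by simp [q1, ht, hq0, h]⟩
    · have h' : ψ δ = -δ := hψδ.resolve_left h
      have ht : t = δ := by simp [t, h]
      exact Or.inr ⟨by simp [p1, ht, hp0, h'], by simp [q1, ht, hq0]⟩
  -- step 2: sort by the code of c
  set σ := Tuple.sort (fun i => E.enc (c1 i))
  have hmono : Monotone ((fun i => E.enc (c1 i)) ∘ σ) := Tuple.monotone_sort _
  set p2 := p1 ∘ σ
  set q2 := q1 ∘ σ
  set c2 := c1 ∘ σ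
  have hM2 : ModelD p2 q2 c2 := hM1.reindex σ σ.injective
  have hc_inj : Function.Injective (fun i => E.enc (c2 i)) := by
    intro i i' h
    by_contra hii
    exact hM2.c_ne hii (E.enc_inj h)
  have hsm : StrictMono (fun i => E.enc (c2 i)) := hmono.strictMono_of_injective hc_inj
  have hσ0 : σ i0 = i0 := by
    have hi0le : i0 ≤ σ.symm i0 := by rw [Fin.le_def]; exact Nat.zero_le _
    have hle : E.enc (c2 i0) ≤ E.enc (c2 (σ.symm i0)) := hmono hi0le
    have h0 : E.enc (c2 (σ.symm i0)) = 0 := by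
      show E.enc (c1 (σ (σ.symm i0))) = 0
      rw [Equiv.apply_symm_apply, hc1, E.enc_zero]
    have h4 := congrArg σ (hc_inj (show E.enc (c2 i0) = E.enc (c2 (σ.symm i0)) by omega) : i0 = σ.symm i0)
    rw [Equiv.apply_symm_apply] at h4
    exact h4
  have hc2 : c2 i0 = 0 := by show c1 (σ i0) = 0; rw [hσ0, hc1]
  have hp2 : p2 i0 = p1 i0 := by show p1 (σ i0) = _; rw [hσ0]
  have hq2 : q2 i0 = q1 i0 := by show q1 (σ i0) = _; rw [hσ0]
  -- the code of c2 at index 1 is at most the code of ψ (c j)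
  have hle1 : E.enc (c2 i1) ≤ E.enc (ψ (c j)) := by
    have hne : σ.symm j ≠ i0 := by
      intro h
      have h4 := congrArg σ h
      rw [Equiv.apply_symm_apply, hσ0] at h4
      exact hj h4
    have hi1le : i1 ≤ σ.symm j := by
      have : (σ.symm j).val ≠ 0 := fun h0 => hne (Fin.ext h0)
      rw [Fin.le_def]; show 1 ≤ (σ.symm j).val; omega
    have h' : E.enc (c1 (σ i1)) ≤ E.enc (c1 (σ (σ.symm j))) := hmono hi1le
    rw [Equiv.apply_symm_apply, hc1j j] at h'
    exact h'
  -- step 3: orient the pairs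
  refine ⟨fun i => if E.enc (p2 i) < E.enc (q2 i) then p2 i else q2 i,
    fun i => if E.enc (p2 i) < E.enc (q2 i) then q2 i else p2 i, c2, hM2.orient E, ⟨fun i i' hii => hsm hii, ?_⟩,
    hc2, ?_, ?_, hle1⟩
  · intro i
    dsimp only
    split_ifs with h
    · exact h
    · have hne : E.enc (p2 i) ≠ E.enc (q2 i) := fun e => hM2.1 i (E.enc_inj e)
      omega
  · show (if E.enc (p2 i0) < E.enc (q2 i0) then p2 i0 else q2 i0) = 0
    rw [hp2, hq2]
    rcases hpair with ⟨hp, hq⟩ | ⟨hp, hq⟩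
    · rw [hp, hq, E.enc_zero, if_pos (Nat.pos_of_ne_zero fun h0 => hδ0 (E.enc_inj (h0.trans E.enc_zero.symm)))]
    · rw [hp, hq, E.enc_zero, if_neg (Nat.not_lt_zero _)]
  · show (if E.enc (p2 i0) < E.enc (q2 i0) then q2 i0 else p2 i0) = δ
    rw [hp2, hq2]
    rcases hpair with ⟨hp, hq⟩ | ⟨hp, hq⟩
    · rw [hp, hq, E.enc_zero, if_pos (Nat.pos_of_ne_zero fun h0 => hδ0 (E.enc_inj (h0.trans E.enc_zero.symm)))]
    · rw [hp, hq, E.enc_zero, if_neg (Nat.not_lt_zero _)]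

/-- **STABILISER NORMAL FORM.** From a normal-form solution with `c₀ = 0`, `A₀ = {0, δ}` and any list of injective additive maps
`ψ` with `ψ δ = ±δ`, a normal-form solution with the same `c₀ = 0`, `A₀ = {0, δ}` exists in which the code of `c₁` does not
exceed the code of any `ψ cⱼ` (`ψ` listed, `j ≠ 0`) — by a well-founded descent on the code of `c₁` along `stabStep`. -/
theorem exists_stabMin (E : GEnc G) (hK : 1 < K) (stabs : List (G →+ G)) {δ : G}
    (hst : ∀ ψ ∈ stabs, Function.Injective ψ ∧ (ψ δ = δ ∨ ψ δ = -δ))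
    {p q c : Fin K → G} (hM : ModelD p q c) (hNF : NF E p q c)
    (hc0 : c ⟨0, by omega⟩ = 0) (hp0 : p ⟨0, by omega⟩ = 0) (hq0 : q ⟨0, by omega⟩ = δ) :
    ∃ p' q' c' : Fin K → G, ModelD p' q' c' ∧ NF E p' q' c' ∧ c' ⟨0, by omega⟩ = 0 ∧ p' ⟨0, by omega⟩ = 0 ∧
      q' ⟨0, by omega⟩ = δ ∧ ∀ ψ ∈ stabs, ∀ j : Fin K, j ≠ ⟨0, by omega⟩ → E.enc (c' ⟨1, hK⟩) ≤ E.enc (ψ (c' j)) := by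
  obtain ⟨n, hn⟩ : ∃ n, E.enc (c ⟨1, hK⟩) = n := ⟨_, rfl⟩
  induction n using Nat.strong_induction_on generalizing p q c with
  | _ n ih =>
    by_cases hP : ∀ ψ ∈ stabs, ∀ j : Fin K, j ≠ ⟨0, by omega⟩ → E.enc (c ⟨1, hK⟩) ≤ E.enc (ψ (c j))
    · exact ⟨p, q, c, hM, hNF, hc0, hp0, hq0, hP⟩
    · simp only [not_forall, not_le, exists_prop] at hP
      obtain ⟨ψ, hψ, j, hj, hlt⟩ := hP
      obtain ⟨p', q', c', hM', hNF', hc0', hp0', hq0', hle⟩ :=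
        stabStep E hK hM hc0 hp0 hq0 ψ (hst ψ hψ).1 (hst ψ hψ).2 j hj
      exact ih (E.enc (c' ⟨1, hK⟩)) (by omega) hM' hNF' hc0' hp0' hq0' rfl

end Stab

/-! ## 4. The reflection theorems (stabiliser normal form, three levels, global mask) -/

section Reflection

variable {G : Type} [AddCommGroup G] {K : ℕ}

/-- `testBit` through `Nat.lor a b = b` (`a ⊆ b` as masks). -/
theorem testBit_of_lor_eq {a b i : ℕ} (h : Nat.lor a b = b) (ha : a.testBit i = true) : b.testBit i = true := by
  have := congrArg (fun m => Nat.testBit m i) h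
  simp only [lor_eq, Nat.testBit_lor, ha, Bool.true_or] at this
  exact this.symm

/-- **REFLECTION THROUGH DEF. 5.1 (stabiliser normal form, three-level chunks, global mask).**  Under the hypotheses of the
file header (all kernel decisions on the group), `G` admits NO STPP family (CKSU Def. 5.1, tree `IsSTPP`) of `K ≥ 2` triples
with `|Aᵢ| = 2`, `|Bᵢ| = |Cᵢ| = 1` — by the tree's criterion `exists_isSTPP_211_iff` (`STPPSmallPatternCriteria.lean`) and the
normal forms `exists_normalForm`, `exists_stabMin`. [cite: CohnKleinbergSzegedyUmans2005, Def. 5.1] -/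
theorem not_exists_isSTPP_211_of_search3 [DecidableEq G] (E : GEnc G) (hK : 1 < K)
    {chunks : List (ℕ × ℕ × ℕ × ℕ × ℕ)} (hsearch : search3 E.g K chunks = true) {dlist : List ℕ}
    {auts : List (G →+ G)} (hinj : ∀ f ∈ auts, Function.Injective f)
    (hcover : ∀ d : G, d ≠ 0 → ∃ f ∈ auts, E.enc (f d) ∈ dlist)
    (stabs : ℕ → List (G →+ G))
    (hstabs : ∀ δ : G, E.enc δ ∈ dlist → ∀ ψ ∈ stabs (E.enc δ), Function.Injective ψ ∧ (ψ δ = δ ∨ ψ δ = -δ))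
    (canon : ℕ → List (ℕ × ℕ))
    (hcanon : ∀ δ : G, E.enc δ ∈ dlist → ∀ y : G, y ≠ 0 → y ≠ δ → y ≠ -δ →
      (∀ ψ ∈ stabs (E.enc δ), E.enc y ≤ E.enc (ψ y)) → ∃ yb ∈ canon (E.enc δ), yb.1 = E.enc y)
    (hB : ∀ δ : G, E.enc δ ∈ dlist → ∀ yb ∈ canon (E.enc δ), ∀ z : G, yb.2.testBit (E.enc z) = true →
      ∃ ψ ∈ stabs (E.enc δ), E.enc (ψ z) < yb.1)
    (hchunks : ∀ d ∈ dlist, ∀ yb ∈ canon d, ∀ y₂, y₂ < E.g.n → yb.2.testBit y₂ = true ∨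
      ((∃ e ∈ chunks, e.1 = d ∧ e.2.1.testBit yb.1 = false ∧ e.2.2.1.testBit y₂ = false ∧
          Nat.lor e.2.2.2.1 yb.2 = yb.2 ∧ Nat.lor e.2.2.2.2 yb.2 = yb.2) ∨
        ∀ y₃, y₃ < E.g.n → yb.2.testBit y₃ = true ∨
          ∃ e ∈ chunks, e.1 = d ∧ e.2.1.testBit yb.1 = false ∧ e.2.2.1.testBit y₂ = false ∧
            e.2.2.2.1.testBit y₃ = false ∧ Nat.lor e.2.2.2.2 yb.2 = yb.2))
    : ¬ ∃ A B C : Fin K → Finset G, IsSTPP A B C ∧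
      ∀ i, (A i).card = 2 ∧ (B i).card = 1 ∧ (C i).card = 1 := by
  rw [exists_isSTPP_211_iff]
  rintro ⟨p, q, c, hpq, hD, hX⟩
  have hM := modelD_of_finsetForm hpq hD hX
  have hK0 : 0 < K := by omega
  obtain ⟨p₁, q₁, c₁, hM₁, hNF₁, hc₁, hp₁, hd⟩ := exists_normalForm E hM hK0 hinj hcover
  set δ := q₁ ⟨0, hK0⟩
  obtain ⟨p', q', c', hM', hNF, hc0, hp0, hq0, hP⟩ :=
    exists_stabMin E hK (stabs (E.enc δ)) (hstabs δ hd) hM₁ hNF₁ hc₁ hp₁ rfl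
  -- y := c'₁ is canonical
  set i0 : Fin K := ⟨0, hK0⟩
  set i1 : Fin K := ⟨1, hK⟩
  obtain ⟨hy0, hyδ, hyδ'⟩ := hM'.c_notMem (show i1 ≠ i0 by simp [i0, i1, Fin.ext_iff]) hc0 hp0 hq0
  obtain ⟨⟨y, b⟩, hyb, hy⟩ := hcanon δ hd (c' i1) hy0 hyδ hyδ' fun ψ hψ => hP ψ hψ i1 (by simp [i0, i1, Fin.ext_iff])
  simp only at hy
  subst hy
  -- no cⱼ (j ≥ 1) is coded inside b
  have hout : ∀ j : Fin K, 1 ≤ j.val → b.testBit (E.enc (c' j)) = false := by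
    intro j hj
    rcases hbit : b.testBit (E.enc (c' j)) with _ | _
    · rfl
    · obtain ⟨ψ, hψ, hlt⟩ := hB δ hd _ hyb (c' j) hbit
      have := hP ψ hψ j fun h => by rw [h] at hj; simp [i0] at hj
      exact absurd hlt (by simp only; omega)
  -- the codes y₂, y₃ to be admitted: those of c'₂, c'₃ if they exist, else that of c'₁
  let j₂ : Fin K := if h2 : 2 < K then ⟨2, h2⟩ else i1
  let j₃ : Fin K := if h3 : 3 < K then ⟨3, h3⟩ else i1
  have hj₂ : 1 ≤ j₂.val := by dsimp only [j₂]; split_ifs <;> simp [i1]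
  have hj₃ : 1 ≤ j₃.val := by dsimp only [j₃]; split_ifs <;> simp [i1]
  have refute : ∀ e ∈ chunks, e.1 = E.enc δ → e.2.1.testBit (E.enc (c' i1)) = false →
      e.2.2.1.testBit (E.enc (c' j₂)) = false → e.2.2.2.1.testBit (E.enc (c' j₃)) = false →
      Nat.lor e.2.2.2.2 b = b → False := by
    intro e he h1 hx1 hx2 hx3 hg
    have := start_of_search3 hsearch e he
    rw [h1, ← hq0, start_false3 hM' hNF hK0 hc0 hp0 (fun _ => hx1)
      (fun h2 => by simpa [j₂, h2] using hx2) (fun h3 => by simpa [j₃, h3] using hx3)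
      (fun j hj => by
        rcases hbit : e.2.2.2.2.testBit (E.enc (c' j)) with _ | _
        · rfl
        · have := testBit_of_lor_eq hg hbit
          rw [hout j hj] at this
          exact absurd this Bool.false_ne_true)] at this
    exact Bool.false_ne_true this
  rcases hchunks (E.enc δ) hd _ hyb (E.enc (c' j₂)) (E.enc_lt _) with hb2 | ⟨e, he, h1, hx1, hx2, hx3, hg⟩ | hall
  · rw [hout j₂ hj₂] at hb2; exact Bool.false_ne_true hb2
  · refine refute e he h1 hx1 hx2 ?_ hg
    rcases hbit : e.2.2.2.1.testBit (E.enc (c' j₃)) with _ | _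
    · rfl
    · have := testBit_of_lor_eq hx3 hbit
      rw [hout j₃ hj₃] at this
      exact absurd this Bool.false_ne_true
  · rcases hall (E.enc (c' j₃)) (E.enc_lt _) with hb3 | ⟨e, he, h1, hx1, hx2, hx3, hg⟩
    · rw [hout j₃ hj₃] at hb3; exact Bool.false_ne_true hb3
    · exact refute e he h1 hx1 hx2 hx3 hg

/-- Two-level chunks are chunks: `belowX3G` with `x3 = xg = 0` is `belowX2`. -/
theorem belowX3G_zero (g : GC) (r x1 x2 : ℕ) : belowX3G g r x1 x2 0 0 = belowX2 g r x1 x2 := by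
  have h1 : ∀ r, belowX1G g r 0 0 = below g r := fun r => by cases r <;> rfl
  have h2 : ∀ r, belowX2G g r x2 0 0 = belowX g r x2 := fun r => by
    cases r with
    | zero => rfl
    | succ r => funext S; show level g S r x2 (belowX1G g r 0 0) = _; rw [h1]; rfl
  cases r with
  | zero => rfl
  | succ r => funext S; show level g S r x1 (belowX2G g r x2 0 0) = _; rw [h2]; rfl

/-- `search2` facts already in the tree are `search3` facts on the padded chunks `(d, x1, x2, 0, 0)`. -/
theorem search3_map_eq_search2 (g : GC) (k : ℕ) (R : List (ℕ × ℕ × ℕ)) :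
    search3 g k (R.map fun e => (e.1, e.2.1, e.2.2, 0, 0)) = search2 g k R := by
  induction R with
  | nil => rfl
  | cons e R ih => rw [List.map_cons, search3_cons, search2_cons, ih, belowX3G_zero]

end Reflection

end STPP211Neg

end Summit.MatrixMultiplication.OmegaCensus
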